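import Literature.AlgebraicGeometry.Motives.ProjectiveSpaceDehomogenize
import HarnessLib

/-!
# The chart algebra of a hypersurface: `(k[x₀,…,x_N]_{xᵢ·h})₀ = k[y₁,…,y_N][1/h(xᵢ := 1)]`

For the graded polynomial ring `k[x₀, …, x_N]` (`N = n + 1`), a variable `xᵢ` and a homogeneous
`h` of degree `e`, the degree-zero localisation `(k[x]_{xᵢ h})₀` — the coordinate ring of the affine
open `D₊(xᵢ h) = D₊(xᵢ) ∩ D₊(h)` of `ℙᴺ_k` (Hartshorne II Prop. 2.5) — is the localisation of the
chart algebra `(k[x]_{xᵢ})₀ ≅ k[y₁, …, y_N]` (`Literature.AlgebraicGeometry.Motives.ProjectiveSpace.chartAlgEquiv`,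
dehomogenisation `xᵢ := 1`) away from the dehomogenised `h(xᵢ := 1)`: Mathlib
`HomogeneousLocalization.Away.isLocalization_mul` says `A_{(fg)} = A_{(f)}[g^{deg f}/f^{deg g}]⁻¹`, and
under the chart isomorphism `h/xᵢᵉ ↦ h(xᵢ := 1)`. We package the composite
`k[y] → (k[x]_{xᵢ})₀ → (k[x]_{xᵢ h})₀` as the `k`-algebra map `chartMap` and record that it is a
localisation away from `dehomogenize i h` (`isLocalization_chartMap`); with the compatibility of
dehomogenisation with partial derivatives (`ProjectiveSpace.pderiv_dehomogenize` of
`Motives/ProjectiveSpaceDehomogenize`) this is the algebraic input of the Jacobian criterion on the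
charts of a projective hypersurface (Hartshorne I Ex. 5.8).

## References

* R. Hartshorne, *Algebraic Geometry*, GTM 52 (1977): I Thm. 3.4 (proof), I Ex. 5.8,
  II Prop. 2.5. [Hartshorne1977]
-/

noncomputable section

open MvPolynomial HomogeneousLocalization

universe u

namespace Literature.AlgebraicGeometry.Motives

namespace ProjectiveSpace

variable (R : Type u) [CommRing R] {n : ℕ} (i : Fin (n + 1))

attribute [local instance] MvPolynomial.gradedAlgebra ProjBaseChange.algebraBase
  ProjBaseChange.isScalarTower_localization

local notation "𝒜" => MvPolynomial.homogeneousSubmodule (Fin (n + 1)) R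

variable {R} in
/-- `toChart` is dehomogenisation read backwards: for `a` homogeneous of degree `m`,
`toChart (a(xᵢ := 1)) = a/xᵢᵐ` (from `toChart ∘ ofChart = id` and `ofChart (a/xᵢᵐ) = a(xᵢ := 1)`).
[folklore] -/
theorem toChart_dehomogenize {m : ℕ} (a : MvPolynomial (Fin (n + 1)) R) (ha : a ∈ 𝒜 m) :
    toChart R i (dehomogenize R i a) = Away.mk 𝒜 (X_mem i) m a (by simpa using ha) := by
  rw [← ofChartRingHom_mk i m a (by simpa using ha)]
  exact toChart_ofChart i _

variable {R} in
/-- Mathlib's element `a^{deg xᵢ}/xᵢ^{deg a} = a/xᵢᵐ` exhibiting `(R[x]_{xᵢ a})₀` as a localisation of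
`(R[x]_{xᵢ})₀` (`HomogeneousLocalization.Away.isLocalizationElem`) is `toChart (a(xᵢ := 1))`.
[folklore] -/
theorem isLocalizationElem_X {m : ℕ} (a : MvPolynomial (Fin (n + 1)) R) (ha : a ∈ 𝒜 m) :
    Away.isLocalizationElem (X_mem i) ha = toChart R i (dehomogenize R i a) := by
  rw [toChart_dehomogenize i a ha]
  refine HomogeneousLocalization.val_injective _ ?_
  simp [Away.isLocalizationElem, Away.val_mk]

variable {R} in
/-- `awayMap : (R[x]_{f})₀ → (R[x]_{fg})₀` is `R`-linear. [folklore] -/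
theorem awayMap_algebraMap {e : ℕ} {f g x : MvPolynomial (Fin (n + 1)) R} (hg : g ∈ 𝒜 e)
    (hx : x = f * g) (r : R) :
    awayMap 𝒜 hg hx (algebraMap R (Away 𝒜 f) r) = algebraMap R (Away 𝒜 x) r :=
  awayMap_fromZeroRingHom 𝒜 hg hx _

end ProjectiveSpace

namespace SmoothHypersurface

open ProjectiveSpace

variable (k : Type u) [CommRing k] {n : ℕ} (i : Fin (n + 2))

attribute [local instance] MvPolynomial.gradedAlgebra ProjBaseChange.algebraBase
  ProjBaseChange.isScalarTower_localization

local notation "𝒜" => MvPolynomial.homogeneousSubmodule (Fin (n + 2)) k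

/-- **The chart map** `k[y₀,…,yₙ] → (k[x₀,…,x_{n+1}]_{xᵢ h})₀`, `yⱼ ↦ x_{i.succAbove j}/xᵢ`: the
chart isomorphism `k[y] ≅ (k[x]_{xᵢ})₀` (Hartshorne I Thm. 3.4, proof) followed by Mathlib's
`awayMap : (k[x]_{xᵢ})₀ → (k[x]_{xᵢ h})₀`, `a/xᵢᵐ ↦ a hᵐ/(xᵢ h)ᵐ` (restriction from `D₊(xᵢ)` to
`D₊(xᵢ h)`, Hartshorne II Prop. 2.5(b)). [folklore] -/
def chartMap {e : ℕ} {h : MvPolynomial (Fin (n + 2)) k} (he : h ∈ 𝒜 e) :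
    MvPolynomial (Fin (n + 1)) k →ₐ[k] Away 𝒜 (X i * h) where
  toRingHom := (awayMap 𝒜 he rfl).comp (toChart k i).toRingHom
  commutes' r := by
    change awayMap 𝒜 he rfl (toChart k i (algebraMap k _ r)) = _
    rw [AlgHom.commutes]
    exact awayMap_algebraMap he rfl r

variable {e : ℕ} {h : MvPolynomial (Fin (n + 2)) k}
  (he : h ∈ MvPolynomial.homogeneousSubmodule (Fin (n + 2)) k e)

/-- `chartMap` is `awayMap ∘ toChart` (unfolding, `rfl`). [folklore] -/
theorem chartMap_apply (p : MvPolynomial (Fin (n + 1)) k) :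
    chartMap k i he p = awayMap 𝒜 he rfl (toChart k i p) := rfl

/-- On a dehomogenised form `F(xᵢ := 1)`, `F` homogeneous of degree `d`, the chart map is
`awayMap (F/xᵢᵈ)`, i.e. `F hᵈ/(xᵢ h)ᵈ`, and `F/xᵢᵈ` is Mathlib's `isLocalizationElem`. [folklore] -/
theorem chartMap_dehomogenize {d : ℕ} (F : MvPolynomial (Fin (n + 2)) k) (hF : F ∈ 𝒜 d) :
    chartMap k i he (dehomogenize k i F) =
      awayMap 𝒜 he rfl (Away.isLocalizationElem (X_mem i) hF) := by
  rw [chartMap_apply, isLocalizationElem_X i F hF]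

/-- **`(k[x]_{xᵢ h})₀ = k[y][1/h(xᵢ := 1)]`**: through `chartMap`, the degree-zero localisation at
`xᵢ h` is the localisation of the polynomial ring `k[y₀,…,yₙ]` away from the dehomogenised `h`
(Mathlib `HomogeneousLocalization.Away.isLocalization_mul`: `A_{(fg)} = A_{(f)}[1/(g^{deg f}/f^{deg g})]`,
transported along the chart isomorphism `(k[x]_{xᵢ})₀ ≅ k[y]` of Hartshorne I Thm. 3.4).
[cite: Hartshorne1977, I Thm. 3.4 (proof) and II Prop. 2.5(b)] -/
theorem isLocalization_chartMap :
    @IsLocalization.Away _ _ (dehomogenize k i h) (Away 𝒜 (X i * h)) _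
      (chartMap k i he).toRingHom.toAlgebra := by
  letI := (awayMap 𝒜 he (rfl : X i * h = X i * h)).toAlgebra
  have hloc := Away.isLocalization_mul (X_mem i) he (rfl : X i * h = X i * h) one_ne_zero
  have := IsLocalization.isLocalization_of_base_ringEquiv
    (Submonoid.powers (Away.isLocalizationElem (X_mem i) he)) (Away 𝒜 (X i * h))
    (chartAlgEquiv k i).toRingEquiv
  rw [Submonoid.map_powers] at this
  have hel : (chartAlgEquiv k i).toRingEquiv (Away.isLocalizationElem (X_mem i) he) =
      dehomogenize k i h := by
    rw [isLocalizationElem_X i h he]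
    exact (chartAlgEquiv k i).apply_symm_apply _
  rw [hel] at this
  convert this
  exact RingHom.ext fun p => rfl

end SmoothHypersurface

end Literature.AlgebraicGeometry.Motives

end
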